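import Literature.MathematicalPhysics.QuantumFieldTheory.Balaban1983to89.B15LeafKnitTower9
import Literature.MathematicalPhysics.QuantumFieldTheory.Balaban1983to89.B15RopTotalSupp
import Literature.MathematicalPhysics.QuantumFieldTheory.Balaban1983to89.Node00.ROperationOfRecord1100

/-!
# `Balaban1983to89.B15RPrime1100OfRep` — T. Bałaban, *Large field renormalization. I. The basic step of the 𝐑 operation*, Commun. Math.
# Phys. **122** (1989) 175–202 [Balaban1989LargeFieldI] («[IV]»), (1.99)–(1.102) pp. 200–201 with (0.2)–(0.4) p. 176: THE OPERATION 𝐑′ (1.100)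
# AS AN OBJECT (r12's `B15Sect1Statements.RPrimeData`) READ AT THE 𝐑-STEP DATA of a representation (0.2) — so that the identification
# «𝐑′ (1.100) of record = the 𝐑-step (0.3)» displayed by the N12 knit (`B15LeafKnitRepr.normalization1102_of_rPrime_eq_rop`,
# `B15LeafKnitMass.normalization1102_of_rPrime_eq_rop_supp`: hypothesis `h1100 : rPrime1100 D1100 = RopReal (rterm r) sel fib`) is a THEOREM,
# (1.99) `Equiv199` and (1.102) `Normalization1102` are PROVED at that datum from the SUPPORT-form provisos (n10-b's `B15FibreLemmaSupp`), and the
# `e1102` conjunct of the [IV] leaf `B15Leaf` at the W pin stops being a displayed hypothesis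

statement-level bookkeeping over published theorems with citation tags; kernel-checked compositions of tree theorems; nothing here is a claim about
the Yang–Mills mass gap.

CITATION HEADER (lean-in-tree rule).  Source: [Balaban1989LargeFieldI] = cell paper B15 = «[IV]»: (0.2)–(0.4) p. 176 (*"(𝐑ρ)(V) = Σ_Z ρ(Z″, V)
∫dV⌈_{Z′} ρ(Z, V) / ∫dV⌈_{Z′} ρ(Z″, V)"*, *"∫dV(𝐑ρ)(V) = ∫dVρ(V)"*), (1.99) p. 200 (*"the equivalence means that both sides have equal integrals"*),
(1.100) p. 201 (𝐑′ — *"not a complete 𝐑-operation yet, but … a basic part of it"*), (1.102) p. 201 (*"∫dV_k(𝐑′ρ_k)(V_k) = ∫dV_kρ_k(V_k)"*); with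
[Balaban1988Convergent] (2.18) p. 257 (the representation the 𝐑-step acts on).  Seat `pub-ymgap-dag-n12-e` (YM-PLAN Track A, HUMAN RULING D-0062,
director-ym R134 row N12 s3 «the (1.80)∕(1.89) + 𝐑′ (1.99)–(1.100) p. 201 chain (`B15RopTotalSupp`)»).  BY NAME and UNCHANGED: r12's
`B15Sect1Statements` (`Insert1100`, `Component1100`, `Family1100`, `RPrimeData`, `rPrime1100`, `bare199`, `Equiv199`, `Normalization1102`) and
`B15Norm1102Object` (`integral_fibreIntegral`, `measurable_fibreIntegral`, `fibreIntegral_le`, `fibreIntegral_nonneg`); b01's `B15BasicStep`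
(`fibreIntegral`, `normTerm`, `RopReal`, `integral_ropReal_eq`); n10-b's `B15FibreLemmaSupp` (`integral_ropReal_eq_supp`, `RepData.ProvisosSupp`,
`RepData.integral_rop_eq_of_provisosSupp`); n12-b's `B15RopTotal` ∕ `B15RopTotalSupp` (`RepData`, `AdmissibleSupp`, `ropTotalSupp`, `integrable_ropTotalSupp`);
def-R's `Node00.RStepRepr218` (`rterm`, `repDataOfSel`) and v2 draft `Node00.ROperationOfRecord1100` (`Admissible1100`, `rPrimeTotal`); n12-a's
`B15LeafKnitRepr` ∕ `B15LeafKnitMass` ∕ `B15LeafKnitTower9` (`WOfRepr`, `b15Leaf_WOfRepr_of_rPrime_mass`, `b15_main_of_refines₅C_WOfRepr_rPrime_mass`,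
`sum_rterm_repTOfRecord9`, `b15_main_of_refines₅C_of_leaf` through them).

WHY THIS FILE.  At every W pin in the tree (`B15LeafKnitRepr.WOfRepr`, `Node00.WOfRecord₁₀ ∕ ₁₁`) the (1.102) conjunct `e1102` of `B15Leaf` reads a
RESIDUAL (1.100)-datum `D1100 : RPrimeData` and is either DISPLAYED (`h1102 : Normalization1102 D1100 (Σ_a t_a)`) or reduced to the displayed
IDENTIFICATION `h1100 : rPrime1100 D1100 = RopReal (rterm r) sel fib` (definer ₇'s reading: «(0.3), (1.100), (1.72) differ in the DATUM they act on, not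
in shape»).  Nobody had CONSTRUCTED the (1.100)-datum of which that identification is true.  This file constructs it — `rPrimeDataOfRep piece pp fib` —
by the COARSE DICTIONARY (said plainly; it is the content of the identification, not an estimate): region `Z` ↦ ONE admissible `Z_k`-index with ONE
𝕋″-form (already performed: the identity on what remains a function of `V_k`), ONE family with ONE renormalized component and ONE localisation datum,
`χ_k(Ω_k^{∼4}) := 1`, `χ_{k,Λ_i} := 1`, weight `1` (all characteristic-function prefactors of the new piece ABSORBED into the insert numerator), INSERT
numerator := the new piece `ρ(Z″, ·)` over the fresh variables `Λ_i := Z′ = fib Z` (denominator = its fibre integral, as printed), OLD localized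
integral operation := `∫dV⌈_{Z′}[ · ]` acting on `exp A″_k := ρ(Z, ·)` (the old piece).  Then, by `rfl`-level unfolding and one `ring` step per term,
`rPrime1100 (rPrimeDataOfRep piece pp fib) = RopReal piece pp fib` ((1.100) = (0.3)), `bare199 (…) = Σ_Z ∫dV⌈_{Z′} ρ(Z, ·)` ((1.99)'s right side), so
(1.99) `Equiv199` holds by Fubini (r12's `integral_fibreIntegral`) and (1.102) `Normalization1102` holds by n10-b's (0.4) in SUPPORT form.  WHAT THE
DICTIONARY DOES NOT CARRY (honest): the fine structure printed in (1.100) — the sums over `{Ω^c_j, Z_j}`, `n`, `{X_1,…,X_n}`, `G_i`, `T_i`, the weights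
`1/N_i`, the separate factors `χ_{k,Λ_i}`, `χ(Λ_i)` of (1.101), `δ_{G_i}` — is COLLAPSED into the index `Z` (def-R's admissible sequences `a ∈ r.Adm`) and
the selector `Z ↦ Z″`; r12's fine-structure route to (1.102) (`B15Norm1102Object.normalization1102_of_fibreModel`) is untouched and remains the reading
that keeps those sums explicit.

WHAT THIS FILE PROVES (0 `sorry`; three small constructors `insert1100OfPiece`, `component1100OfPiece`, `rPrimeDataOfRep` + two abbreviating defs).
§1 generic over `(piece, pp, fib)`: `insert1100OfPiece_num ∕ _den`, `component1100OfPiece_op` (= `normTerm`), `_bareOp` (= `fibreIntegral`),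
   `curly_rPrimeDataOfRep`, `bareCurly_rPrimeDataOfRep`, **`rPrime1100_rPrimeDataOfRep`** (= `RopReal piece pp fib`), `bare199_rPrimeDataOfRep`,
   `integral_bare199_rPrimeDataOfRep` + **`equiv199_rPrimeDataOfRep`** ((1.99) PROVED), **`normalization1102_rPrimeDataOfRep_supp`** ((1.102) PROVED on the
   support proviso), `normalization1102_rPrimeDataOfRep` (pointwise-proviso twin).
§2 at a representation datum `d : RepData`: `RepData.rPrimeData`, `rPrime1100_rPrimeData` (= `d.rop`), `equiv199_rPrimeData`,
   `normalization1102_rPrimeData_of_provisosSupp`; junctions `ropTotalSupp_eq_rPrime1100_of_admissibleSupp` (n12-b's support-form total operator IS 𝐑′ of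
   the datum's (1.100)-reading on the admissible branch), `admissible1100_rPrimeData_of_admissibleSupp`, `rPrimeTotal_rPrimeData_eq_ropTotalSupp` (def-R's v2
   total 𝐑′-operator at the extraction `rPrimeData ∘ rep` AGREES with `ropTotalSupp rep` on support-admissible integrable densities); A2 witness
   `normalization1102_rPrimeData_trivialRep` (the hypothesis list is satisfiable: definer ₇'s one-region representation).
§3 at the 𝐑-step data `(r, sel, fib)` of a (2.18) representation: `rPrimeDataOfSel`, `rPrimeDataOfSel_eq` (`rfl`), **`rPrime1100_rPrimeDataOfSel`** (THE `h1100`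
   of n12-a's hooks), `normalization1102_rPrimeDataOfSel_supp`, **`b15Leaf_WOfRepr_rPrimeDataOfSel_of_mass`** (the [IV] leaf at `WOfRepr r sel fib LF D189
   (rPrimeDataOfSel r sel fib)` from mass + support provisos + EXACTLY Proposition 1 (1.78), (1.80), (1.89)), hook `b15_main_of_refines₅C_WOfRepr_rPrimeDataOfSel`.
§4 at the represented tower of record: **`b15Leaf_WOfTower9_rPrimeDataOfSel_of_mass`**, hook **`b15_main_of_refines₅C_WOfTower9_rPrimeDataOfSel`** — N12 OF
   RECORD over any refinement pinning `res.W P` to the tower bundle WITH `D1100 := rPrimeDataOfSel (Tstep rep_k) (ppSel … (k+1)) (fibOfSeq … (k+1))`,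
   modulo the provisos and EXACTLY Proposition 1 (1.78), (1.80), (1.89) — one displayed [IV] statement FEWER than `b15_main_of_refines₅C_WOfTower9`.

HONEST FRAMING.  A count-neutral landing: one dictionary-level constructor + kernel bookkeeping over landed modules by name; the pin `D1100 := rPrimeDataOfSel …`
is this seat's PROPOSAL for NODE 00's residual [IV] layer `ResidW` (node00-def ∕ def-T's definition to make); N12 is NOT discharged — after the pin it is the
positive-mass + support provisos and EXACTLY Proposition 1 (1.78), (1.80), (1.89) at the objects of record; nothing of Bałaban's asserted; no estimate; one
finite four-torus programme at fixed `ε`, Bałaban AS PRINTED with locators; nothing continuum ∕ ℝ⁴ ∕ OS ∕ mass gap ∕ Clay.  No `sorry`, no `axiom`, no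
`instance`, no `notation`.
-/

noncomputable section

open scoped BigOperators
open MeasureTheory

namespace Literature.MathematicalPhysics.QuantumFieldTheory.Balaban1983to89.B15RPrime1100OfRep

open B15.BasicStep (fibreIntegral normTerm RopReal integral_ropReal_eq integral_ropReal_eq_supp)
open B15Sect1Statements (Insert1100 Component1100 Family1100 RPrimeData rPrime1100 bare199 Equiv199 Normalization1102)
open B15Norm1102Object (integral_fibreIntegral measurable_fibreIntegral fibreIntegral_nonneg fibreIntegral_le)

/-! ## §1. The (1.100)-datum READ AT representation data `(piece, pp, fib)` — the coarse dictionary -/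

section Generic

variable {P : Params} {j : ℕ} {G : Type*} [GaugeGroup G] [MeasurableSpace G] [HaarData G] [DecidableEq (PBond P j)]

omit [DecidableEq (PBond P j)] in
/-- A bounded, nonnegative, measurable density is integrable over the (probability) field measure. [folklore] -/
private theorem integrable_of_bdd {f : Density P j G} (hm : Measurable f) (h0 : ∀ V, 0 ≤ f V) {C : ℝ} (hC : ∀ V, f V ≤ C) :
    Integrable f (fieldMeasure P j G) :=
  (integrable_const C).mono' hm.aestronglyMeasurable
    (Filter.Eventually.of_forall (fun V => by rw [Real.norm_eq_abs, abs_of_nonneg (h0 V)]; exact hC V))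

/-- **The small-field INSERT of (1.100) READ AT a new piece**: fresh variables `Λ_i := lam` (= `Z′`), the numerator factors
`δ_{G_i}(V′_k)·χ(Λ_i)·exp[−g_k⁻²A(…)]` := `new · 1 · exp 0` — the whole new piece `ρ(Z″, ·)` ABSORBED into the first factor (coarse dictionary).
[cite: Balaban1989LargeFieldI, (1.100) p.201, (0.3) p.176] -/
def insert1100OfPiece (lam : Finset (PBond P j)) (new : Density P j G) : Insert1100 P j G where
  lam := lam
  gaugeDelta := new
  chiΛ := fun _ => 1
  gk := 1
  action := fun _ => 0

omit [DecidableEq (PBond P j)] in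
/-- Its numerator IS the new piece. [cite: Balaban1989LargeFieldI, (1.100) p.201 (bookkeeping)] -/
theorem insert1100OfPiece_num (lam : Finset (PBond P j)) (new : Density P j G) : (insert1100OfPiece lam new).num = new := by
  funext V
  simp [Insert1100.num, insert1100OfPiece]

/-- Its denominator IS `∫dV⌈_{Z′} ρ(Z″, ·)`. [cite: Balaban1989LargeFieldI, (1.100) p.201, (0.3) p.176 (bookkeeping)] -/
theorem insert1100OfPiece_den (lam : Finset (PBond P j)) (new : Density P j G) :
    (insert1100OfPiece lam new).den = fibreIntegral lam new := by
  unfold Insert1100.den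
  rw [insert1100OfPiece_num]
  rfl

/-- **ONE renormalized component of (1.100) READ AT a new piece over `Z′`**: one localisation datum, weight `1`, `χ_{k,Λ_i} := 1`, the insert above, and
the OLD localized integral operation := `∫dV⌈_{Z′}[ · ]` acting on what stands to its right. [cite: Balaban1989LargeFieldI, (1.100) p.201, (0.3) p.176] -/
def component1100OfPiece (lam : Finset (PBond P j)) (new : Density P j G) : Component1100 P j G where
  Loc := Unit
  weight := 1
  chiKΛ := fun _ _ => 1
  ins := fun _ => insert1100OfPiece lam new
  oldOp := fun _ ρ => fibreIntegral lam ρ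

/-- **Its bracket acting on `old` IS the normalized term** `new · ∫dV⌈_{Z′} old ∕ ∫dV⌈_{Z′} new` of (0.3) (b01's `normTerm`).
[cite: Balaban1989LargeFieldI, (1.100) p.201, (0.3) p.176] -/
theorem component1100OfPiece_op (lam : Finset (PBond P j)) (new old : Density P j G) :
    (component1100OfPiece lam new).op old = normTerm lam new old := by
  funext V
  simp only [Component1100.op, component1100OfPiece, Fintype.sum_unique, Insert1100.ratio, insert1100OfPiece_den, insert1100OfPiece_num,
    normTerm, one_mul]
  rw [div_mul_eq_mul_div, mul_div_assoc]

/-- Its bracket WITHOUT the insert acting on `old` IS `∫dV⌈_{Z′} old` (the (1.99) side). [cite: Balaban1989LargeFieldI, (1.99) p.201] -/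
theorem component1100OfPiece_bareOp (lam : Finset (PBond P j)) (new old : Density P j G) :
    (component1100OfPiece lam new).bareOp old = fibreIntegral lam old := by
  funext V
  simp only [Component1100.bareOp, component1100OfPiece, Fintype.sum_unique, one_mul]

omit [DecidableEq (PBond P j)] in
/-- `n = 1`, no inserts: the single component's bare bracket (`rfl`, as r12's `prodOp_one`). [cite: Balaban1989LargeFieldI, (1.99) p.201 (bookkeeping)] -/
theorem bareProdOp_one (chiK4 : Density P j G) (C : Component1100 P j G) : (Family1100.mk 1 chiK4 fun _ => C).bareProdOp = C.bareOp := by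
  rfl

/-- **THE (1.100)-DATUM READ AT REPRESENTATION DATA** `(piece, pp, fib)` ((0.2): regions `Z : R`, `Z ↦ Z″ = pp Z`, fresh variables `Z′ = fib Z`, pieces
`ρ(Z, ·) = piece Z`) — THE COARSE DICTIONARY: `Z_k`-indices := `R`; 𝕋″-forms := one, the identity; families := one, `χ_k(Ω_k^{∼4}) := 1`, ONE component
`component1100OfPiece (fib Z) (piece (pp Z))`; `exp A″_k := piece Z`. [cite: Balaban1989LargeFieldI, (1.100) p.201, (0.2)–(0.3) p.176] -/
def rPrimeDataOfRep {R : Type} [Fintype R] (piece : R → Density P j G) (pp : R → R) (fib : R → Finset (PBond P j)) : RPrimeData P j G where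
  ZK := R
  TT := fun _ => Unit
  ttOp := fun _ _ ρ => ρ
  Fam := fun _ => Unit
  fam := fun Z _ => ⟨1, fun _ => 1, fun _ => component1100OfPiece (fib Z) (piece (pp Z))⟩
  expA := piece

variable {R : Type} [Fintype R] (piece : R → Density P j G) (pp : R → R) (fib : R → Finset (PBond P j))

/-- Its curly bracket at `Z` IS the (0.3) term `ρ(Z″,·)·∫dV⌈_{Z′}ρ(Z,·)∕∫dV⌈_{Z′}ρ(Z″,·)`. [cite: Balaban1989LargeFieldI, (1.100) p.201, (0.3) p.176] -/
theorem curly_rPrimeDataOfRep (Z : R) : (rPrimeDataOfRep piece pp fib).curly Z = normTerm (fib Z) (piece (pp Z)) (piece Z) := by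
  funext V
  simp [RPrimeData.curly, rPrimeDataOfRep, Family1100.prodOp, component1100OfPiece_op]

/-- Its bare curly bracket at `Z` IS `∫dV⌈_{Z′}ρ(Z,·)`. [cite: Balaban1989LargeFieldI, (1.99) p.201] -/
theorem bareCurly_rPrimeDataOfRep (Z : R) : (rPrimeDataOfRep piece pp fib).bareCurly Z = fibreIntegral (fib Z) (piece Z) := by
  funext V
  simp [RPrimeData.bareCurly, rPrimeDataOfRep, Family1100.bareProdOp, component1100OfPiece_bareOp]

/-- **(1.100) READ AT THE DATA IS (0.3) OF THE DATA**: `rPrime1100 (rPrimeDataOfRep piece pp fib) = RopReal piece pp fib` — the identification the N12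
knit displays as `h1100`, now a theorem of the dictionary. [cite: Balaban1989LargeFieldI, (1.100) p.201, (0.3) p.176] -/
theorem rPrime1100_rPrimeDataOfRep : rPrime1100 (rPrimeDataOfRep piece pp fib) = RopReal piece pp fib := by
  funext V
  have hc := fun Z => congrFun (curly_rPrimeDataOfRep piece pp fib Z) V
  simp only [rPrime1100, RopReal]
  refine Finset.sum_congr rfl fun Z _ => ?_
  rw [← hc Z]
  simp [rPrimeDataOfRep]

/-- **The (1.99) side READ AT THE DATA**: `bare199 (rPrimeDataOfRep piece pp fib) = Σ_Z ∫dV⌈_{Z′} ρ(Z, ·)`. [cite: Balaban1989LargeFieldI, (1.99) pp.200–201] -/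
theorem bare199_rPrimeDataOfRep : bare199 (rPrimeDataOfRep piece pp fib) = fun V => ∑ Z, fibreIntegral (fib Z) (piece Z) V := by
  funext V
  have hc := fun Z => congrFun (bareCurly_rPrimeDataOfRep piece pp fib Z) V
  simp only [bare199]
  refine Finset.sum_congr rfl fun Z _ => ?_
  rw [← hc Z]
  simp [rPrimeDataOfRep]

/-- The (1.99) side has the integral of `Σ_Z ρ(Z, ·)` (Fubini for each fibre integral: r12's `integral_fibreIntegral`), for measurable, nonnegative,
uniformly bounded pieces. [cite: Balaban1989LargeFieldI, (1.99) p.200 («both sides have equal integrals»)] -/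
theorem integral_bare199_rPrimeDataOfRep (hm : ∀ Z, Measurable (piece Z)) (h0 : ∀ Z V, 0 ≤ piece Z V) {C : ℝ} (hC : ∀ Z V, piece Z V ≤ C) :
    ∫ V, bare199 (rPrimeDataOfRep piece pp fib) V ∂(fieldMeasure P j G) = ∫ V, ∑ Z, piece Z V ∂(fieldMeasure P j G) := by
  rw [bare199_rPrimeDataOfRep]
  have hC0 : ∀ Z V, piece Z V ≤ max C 0 := fun Z V => (hC Z V).trans (le_max_left _ _)
  have hint : ∀ Z, Integrable (piece Z) (fieldMeasure P j G) := fun Z => integrable_of_bdd (hm Z) (h0 Z) (hC Z)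
  have hintF : ∀ Z, Integrable (fibreIntegral (fib Z) (piece Z)) (fieldMeasure P j G) := fun Z =>
    integrable_of_bdd (measurable_fibreIntegral (fib Z) (hm Z)) (fibreIntegral_nonneg (fib Z) (piece Z))
      (fun V => fibreIntegral_le (fib Z) (hC0 Z) (le_max_right _ _) V)
  rw [integral_finsetSum _ (fun Z _ => hintF Z), integral_finsetSum _ (fun Z _ => hint Z)]
  exact Finset.sum_congr rfl fun Z _ => integral_fibreIntegral (fib Z) (hm Z) (h0 Z) (hC Z)

/-- **(1.99) PROVED at the datum read at the data**: `Equiv199 (rPrimeDataOfRep piece pp fib) (Σ_Z ρ(Z, ·))` — the density and its (1.99) form have equal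
integrals. [cite: Balaban1989LargeFieldI, (1.99) p.200] -/
theorem equiv199_rPrimeDataOfRep (hm : ∀ Z, Measurable (piece Z)) (h0 : ∀ Z V, 0 ≤ piece Z V) {C : ℝ} (hC : ∀ Z V, piece Z V ≤ C) :
    Equiv199 (rPrimeDataOfRep piece pp fib) (fun V => ∑ Z, piece Z V) :=
  (integral_bare199_rPrimeDataOfRep piece pp fib hm h0 hC).symm

/-- **(1.102) PROVED at the datum read at the data, SUPPORT FORM**: for measurable, nonnegative, uniformly bounded pieces with *«where `∫dV⌈_{Z′}ρ(Z″,·)`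
vanishes at `V`, `ρ(Z, V) = 0`»* (n10-b's reading of p. 176 *«the denominators are positive»*), `∫dV(𝐑′ρ)(V) = ∫dVρ(V)` for `ρ = Σ_Z ρ(Z, ·)` — the
identification + n10-b's `integral_ropReal_eq_supp`. [cite: Balaban1989LargeFieldI, (1.102) p.201, (0.4) p.176] -/
theorem normalization1102_rPrimeDataOfRep_supp (hm : ∀ Z, Measurable (piece Z)) (h0 : ∀ Z V, 0 ≤ piece Z V) {C : ℝ} (hC : ∀ Z V, piece Z V ≤ C)
    (hsupp : ∀ Z V, fibreIntegral (fib Z) (piece (pp Z)) V = 0 → piece Z V = 0) :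
    Normalization1102 (rPrimeDataOfRep piece pp fib) (fun V => ∑ Z, piece Z V) := by
  unfold Normalization1102
  rw [rPrime1100_rPrimeDataOfRep]
  exact integral_ropReal_eq_supp piece pp fib hm h0 hC hsupp

/-- (1.102) at the datum read at the data, POINTWISE-proviso twin (denominators nowhere zero; b01's `integral_ropReal_eq`).
[cite: Balaban1989LargeFieldI, (1.102) p.201, (0.4) p.176] -/
theorem normalization1102_rPrimeDataOfRep (hm : ∀ Z, Measurable (piece Z)) (h0 : ∀ Z V, 0 ≤ piece Z V) {C : ℝ} (hC : ∀ Z V, piece Z V ≤ C)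
    (hden : ∀ Z V, fibreIntegral (fib Z) (piece (pp Z)) V ≠ 0) :
    Normalization1102 (rPrimeDataOfRep piece pp fib) (fun V => ∑ Z, piece Z V) := by
  unfold Normalization1102
  rw [rPrime1100_rPrimeDataOfRep]
  exact integral_ropReal_eq piece pp fib hm h0 hC hden

end Generic

end Literature.MathematicalPhysics.QuantumFieldTheory.Balaban1983to89.B15RPrime1100OfRep

/-! ## §2. At a representation datum `d : RepData` (n12-b), and the two total operators -/

namespace Literature.MathematicalPhysics.QuantumFieldTheory.Balaban1983to89.B15RopTotal

open B15.BasicStep (fibreIntegral RopReal)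
open B15Sect1Statements (RPrimeData rPrime1100 Equiv199 Normalization1102)
open B15RPrime1100OfRep (rPrimeDataOfRep rPrime1100_rPrimeDataOfRep equiv199_rPrimeDataOfRep)

section WithInst

variable {P : Params} {j : ℕ} {G : Type*} [GaugeGroup G] [MeasurableSpace G] [HaarData G] [DecidableEq (PBond P j)]

namespace RepData

variable (d : RepData P j G)

/-- **The (1.100)-datum OF a representation datum** (coarse dictionary, at the datum's own `Fintype` structure). [cite: Balaban1989LargeFieldI, (1.100) p.201, (0.2) p.176] -/
def rPrimeData : RPrimeData P j G :=
  letI := d.fin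
  rPrimeDataOfRep d.piece d.pp d.fib

/-- **𝐑′ of the datum's (1.100)-reading IS the datum's (0.3)**: `rPrime1100 d.rPrimeData = d.rop`. [cite: Balaban1989LargeFieldI, (1.100) p.201, (0.3) p.176] -/
theorem rPrime1100_rPrimeData : rPrime1100 d.rPrimeData = d.rop := by
  letI := d.fin
  exact rPrime1100_rPrimeDataOfRep d.piece d.pp d.fib

/-- (1.99) at the datum: its total and the (1.99) form of its (1.100)-reading have equal integrals (measurable ∕ ≥ 0 ∕ bounded pieces — the first three
support-form provisos). [cite: Balaban1989LargeFieldI, (1.99) p.200] -/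
theorem equiv199_rPrimeData (h : d.ProvisosSupp) : Equiv199 d.rPrimeData d.total := by
  letI := d.fin
  obtain ⟨hm, h0, ⟨C, hC⟩, -⟩ := h
  exact equiv199_rPrimeDataOfRep d.piece d.pp d.fib hm h0 hC

/-- **(1.102) FOR THE DATUM'S (1.100)-READING under the support-form provisos**: `Normalization1102 d.rPrimeData d.total` — n10-b's
`integral_rop_eq_of_provisosSupp` through the identification. [cite: Balaban1989LargeFieldI, (1.102) p.201, (0.4) p.176] -/
theorem normalization1102_rPrimeData_of_provisosSupp (h : d.ProvisosSupp) : Normalization1102 d.rPrimeData d.total := by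
  unfold Normalization1102
  rw [rPrime1100_rPrimeData]
  exact d.integral_rop_eq_of_provisosSupp h

end RepData

/-- **n12-b's support-form total operator IS 𝐑′ (1.100) of the datum's (1.100)-reading on the admissible branch**: for `AdmissibleSupp rep ρ`,
`ropTotalSupp rep ρ = rPrime1100 (rep ρ).rPrimeData`. [cite: Balaban1989LargeFieldI, (1.100) p.201, (0.3) p.176] -/
theorem ropTotalSupp_eq_rPrime1100_of_admissibleSupp {rep : Density P j G → RepData P j G} {ρ : Density P j G} (h : AdmissibleSupp rep ρ) :
    ropTotalSupp rep ρ = rPrime1100 (rep ρ).rPrimeData := by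
  rw [ropTotalSupp_of_admissible h, RepData.rPrime1100_rPrimeData]

/-- **A2 — the hypothesis list is SATISFIABLE**: at definer ₇'s one-region representation `trivialRep 1` (one region `Z = Z″`, no fresh variables, piece
`≡ 1`; NOT an object of record) the support-form provisos hold and (1.102) for its (1.100)-reading is the theorem above. [cite: Balaban1989LargeFieldI, (1.102) p.201, (0.2) p.176 (bookkeeping witness)] -/
theorem normalization1102_rPrimeData_trivialRep :
    Normalization1102 (Node00.trivialRep (fun _ : GaugeField P j G => (1 : ℝ))).rPrimeData
      (Node00.trivialRep (fun _ : GaugeField P j G => (1 : ℝ))).total :=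
  RepData.normalization1102_rPrimeData_of_provisosSupp _
    ⟨fun _ => measurable_const, fun _ _ => zero_le_one, ⟨1, fun _ _ => le_rfl⟩, fun _ V h => by
      exfalso
      have h1 : fibreIntegral (∅ : Finset (PBond P j)) (fun _ : GaugeField P j G => (1 : ℝ)) V = 1 := by
        simp [fibreIntegral, lmarginal]
      exact one_ne_zero (h1.symm.trans h)⟩

end WithInst

section ClassicalInst

variable {P : Params} {j : ℕ} {G : Type*} [GaugeGroup G] [MeasurableSpace G] [HaarData G]

/-- **def-R's v2 admissibility holds at the (1.100)-reading of a support-admissible datum of an integrable density**: (1.102) by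
`normalization1102_rPrimeData_of_provisosSupp` and integrability of `rPrime1100 (rep ρ).rPrimeData = (rep ρ).rop = ropTotalSupp rep ρ` by n12-b's
`integrable_ropTotalSupp` (any bond decidability). [cite: Balaban1989LargeFieldI, (1.102) p.201 (bookkeeping)] -/
theorem admissible1100_rPrimeData_of_admissibleSupp [DecidableEq (PBond P j)] {rep : Density P j G → RepData P j G} {ρ : Density P j G}
    (h : AdmissibleSupp rep ρ) (hρ : Integrable ρ (fieldMeasure P j G)) : Node00.Admissible1100 (rep ρ).rPrimeData ρ := by
  refine ⟨?_, ?_⟩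
  · have h1 := (rep ρ).normalization1102_rPrimeData_of_provisosSupp h.2
    rw [h.1] at h1
    exact h1
  · rw [← ropTotalSupp_eq_rPrime1100_of_admissibleSupp h]
    exact integrable_ropTotalSupp rep hρ

/-- **def-R's v2 total 𝐑′-operator (`Node00.rPrimeTotal`) at the extraction `ρ ↦ (rep ρ).rPrimeData` AGREES with n12-b's `ropTotalSupp rep`** on every
support-admissible integrable density (both are (0.3) = (1.100) of the datum there).  Stated at def-R's CLASSICAL bond decidability (inline `letI`), as
`rPrimeTotal` is (TS-8; transfer to another instance by `Subsingleton.elim`). [cite: Balaban1989LargeFieldI, (1.100) p.201, (0.3) p.176 (bookkeeping)] -/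
theorem rPrimeTotal_rPrimeData_eq_ropTotalSupp {rep : Density P j G → RepData P j G} {ρ : Density P j G} (hρ : Integrable ρ (fieldMeasure P j G)) :
    letI : DecidableEq (PBond P j) := fun a b => Classical.propDecidable (a = b)
    AdmissibleSupp rep ρ → Node00.rPrimeTotal (fun ρ' => (rep ρ').rPrimeData) ρ = ropTotalSupp rep ρ := by
  intro h
  letI : DecidableEq (PBond P j) := fun a b => Classical.propDecidable (a = b)
  rw [Node00.rPrimeTotal_of_admissible (rep := fun ρ' => (rep ρ').rPrimeData) (admissible1100_rPrimeData_of_admissibleSupp h hρ)]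
  exact (ropTotalSupp_eq_rPrime1100_of_admissibleSupp h).symm

end ClassicalInst

end Literature.MathematicalPhysics.QuantumFieldTheory.Balaban1983to89.B15RopTotal

/-! ## §3. At the 𝐑-step data `(r, sel, fib)` of a (2.18) representation: the `h1100` of the N12 knit is a theorem -/

namespace Literature.MathematicalPhysics.QuantumFieldTheory.Balaban1983to89.B15RPrime1100OfRep

open DagBinding T4Continuum Node00
open B15 (Prop1Printed Ineq180)
open B15.BasicStep (fibreIntegral normTerm RopReal Claim189)
open B15Sect1Statements (RPrimeData rPrime1100 Normalization1102)
open B15Claim189Assembly (Setting189 new189 chiPP dom)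
open B8Eq17ClassAkV1 (plaqsOf)
open B15RopTotal (RepData)
open B15LeafKnitRepr (WOfRepr)
open B15LeafKnitRecord7 (b15_main_of_refines₅C_of_leaf)
open B15LeafKnitMass (normalization1102_of_rPrime_eq_rop_supp b15Leaf_WOfRepr_of_rPrime_mass)
open B15LeafKnitTower9 (sum_rterm_repTOfRecord9)

section Sel

variable {P : Params} {j : ℕ} {G : Type} [GaugeGroup G] [MeasurableSpace G] [HaarData G] [DecidableEq (PBond P j)]
variable {P₀ : Params} {C ι : Type}
variable (r : Step.Repr218 P G j) (sel : r.Adm → r.Adm) (fib : r.Adm → Finset (PBond P j)) (LF : B15.LFVar) (D189 : Setting189 P₀ G C ι)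

/-- **THE (1.100)-DATUM OF THE 𝐑-STEP of a (2.18) representation**: `rPrimeDataOfRep (rterm r) sel fib` — regions := the admissible sequences, new piece
`t_{a″}`, old piece `t_a`, fresh variables `fib a`. [cite: Balaban1989LargeFieldI, (1.100) p.201, (0.3) p.176; Balaban1988Convergent, (2.18) p.257] -/
def rPrimeDataOfSel : RPrimeData P j G := rPrimeDataOfRep (rterm r) sel fib

/-- It IS the (1.100)-reading of definer ₇'s datum `repDataOfSel r sel fib` (`rfl`). [cite: Balaban1989LargeFieldI, (0.2) p.176 (bookkeeping)] -/
theorem rPrimeDataOfSel_eq : rPrimeDataOfSel r sel fib = (repDataOfSel r sel fib).rPrimeData := rfl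

/-- **THE IDENTIFICATION `h1100` OF THE N12 KNIT, PROVED**: `rPrime1100 (rPrimeDataOfSel r sel fib) = RopReal (rterm r) sel fib` — 𝐑′ (1.100) of record
read at the 𝐑-step IS the 𝐑-step (0.3). [cite: Balaban1989LargeFieldI, (1.100) p.201, (0.3) p.176] -/
theorem rPrime1100_rPrimeDataOfSel : rPrime1100 (rPrimeDataOfSel r sel fib) = RopReal (rterm r) sel fib :=
  rPrime1100_rPrimeDataOfRep (rterm r) sel fib

/-- **(1.102) at the 𝐑-step, SUPPORT FORM, with NO identification hypothesis**: under n10-b's `(repDataOfSel r sel fib).ProvisosSupp`,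
`Normalization1102 (rPrimeDataOfSel r sel fib) (Σ_a t_a)` (n12-a's `normalization1102_of_rPrime_eq_rop_supp` fed the proved `h1100`).
[cite: Balaban1989LargeFieldI, (1.102) p.201, (0.4) p.176] -/
theorem normalization1102_rPrimeDataOfSel_supp (hsupp : (repDataOfSel r sel fib).ProvisosSupp) :
    Normalization1102 (rPrimeDataOfSel r sel fib) (fun V => ∑ a, rterm r a V) :=
  normalization1102_of_rPrime_eq_rop_supp r sel fib (rPrimeDataOfSel r sel fib) (rPrime1100_rPrimeDataOfSel r sel fib) hsupp

/-- **THE [IV] LEAF AT THE PIN `WOfRepr r sel fib LF D189 (rPrimeDataOfSel r sel fib)`** — the (1.100) data PINNED to the 𝐑-step's own reading — from the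
terms measurable ∕ ≥ 0 ∕ bounded ∕ of positive mass, the support-form provisos, and EXACTLY Proposition 1 (1.78), (1.80) on the ℍ-domains, (1.89); the
(0.4), (0.6) AND (1.102) conjuncts are theorems (n12-a's `b15Leaf_WOfRepr_of_rPrime_mass` with `h1100` discharged).
[cite: Balaban1989LargeFieldI, (0.2)–(0.6) p.176, Prop. 1 (1.78) p.194, (1.80) p.195, (1.89) p.198, (1.99)–(1.102) pp.200–201] -/
theorem b15Leaf_WOfRepr_rPrimeDataOfSel_of_mass (hm : ∀ a, Measurable (rterm r a)) (h0 : ∀ a V, 0 ≤ rterm r a V) {Cρ : ℝ}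
    (hC : ∀ a V, rterm r a V ≤ Cρ) (hmass : ∀ a, 0 < ∫ V, rterm r a V ∂(fieldMeasure P j G)) (hsupp : (repDataOfSel r sel fib).ProvisosSupp)
    (hP1 : Prop1Printed LF)
    (h180 : ∀ U, new189 D189 U → ∀ i, D189.h ≤ i → i ≤ D189.k → ∀ p ∈ plaqsOf (dom D189 i),
      Ineq180 (D189.dev0 U p) (D189.ε D189.k) D189.η D189.B₃ D189.B₅ D189.M D189.δ (D189.dist p) D189.O1)
    (h189 : Claim189 (new189 D189) (chiPP D189)) :
    B15Leaf (WOfRepr r sel fib LF D189 (rPrimeDataOfSel r sel fib)) :=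
  b15Leaf_WOfRepr_of_rPrime_mass r sel fib LF D189 (rPrimeDataOfSel r sel fib) hm h0 hC hmass hsupp hP1 h180 h189
    (rPrime1100_rPrimeDataOfSel r sel fib)

end Sel

section Hook

variable {F : T4Family} {N : ℕ} [NeZero N] {w : WorldP}

/-- **N12 OF RECORD over any refinement pinning `res.W P := WOfRepr (rOf θ P) (selOf θ P) (fibOf θ P) (LF θ P) (D189 θ P) (rPrimeDataOfSel …)`** —
the (1.100) data of every run PINNED to the 𝐑-step's own (1.100)-reading: per admissible `θ` and run, terms measurable ∕ ≥ 0 ∕ bounded ∕ of positive mass,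
the support-form provisos, and EXACTLY Proposition 1 (1.78), (1.80) on the ℍ-domains, (1.89) ⇒ `Dag.B15_main (leavesP w P)` at every run of every record
world.  n12-a's `b15_main_of_refines₅C_WOfRepr_rPrime_mass` with its `h1100` DISCHARGED — one displayed hypothesis fewer.
[cite: Balaban1989LargeFieldI, Prop. 1 (1.78) p.194, (0.2)–(0.6) p.176, (1.80) p.195, (1.89) p.198, (1.99)–(1.102) pp.200–201] -/
theorem b15_main_of_refines₅C_WOfRepr_rPrimeDataOfSel {Θ : Type*} (toS5 : Θ → Stage5Params F N) (Adm : Θ → Prop)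
    {Par : Θ → B12.RunParams → Params} {lev : Θ → B12.RunParams → ℕ} [∀ θ Pr, DecidableEq (PBond (Par θ Pr) (lev θ Pr))]
    {P₀ : Θ → B12.RunParams → Params} {Cfg ι : Θ → B12.RunParams → Type}
    (rOf : ∀ θ Pr, Step.Repr218 (Par θ Pr) (SU N) (lev θ Pr)) (selOf : ∀ θ Pr, (rOf θ Pr).Adm → (rOf θ Pr).Adm)
    (fibOf : ∀ θ Pr, (rOf θ Pr).Adm → Finset (PBond (Par θ Pr) (lev θ Pr)))
    (LF : Θ → B12.RunParams → B15.LFVar) (D189 : ∀ θ Pr, Setting189 (P₀ θ Pr) (SU N) (Cfg θ Pr) (ι θ Pr))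
    (hpin : ∀ θ, Adm θ → ∀ Pr : B12.RunParams,
      (toS5 θ).res.W Pr = WOfRepr (rOf θ Pr) (selOf θ Pr) (fibOf θ Pr) (LF θ Pr) (D189 θ Pr) (rPrimeDataOfSel (rOf θ Pr) (selOf θ Pr) (fibOf θ Pr)))
    (hm : ∀ θ, Adm θ → ∀ (Pr : B12.RunParams) a, Measurable (rterm (rOf θ Pr) a))
    (h0 : ∀ θ, Adm θ → ∀ (Pr : B12.RunParams) a V, 0 ≤ rterm (rOf θ Pr) a V)
    (hC : ∀ θ, Adm θ → ∀ Pr : B12.RunParams, ∃ Cρ : ℝ, ∀ a V, rterm (rOf θ Pr) a V ≤ Cρ)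
    (hmass : ∀ θ, Adm θ → ∀ (Pr : B12.RunParams) a, 0 < ∫ V, rterm (rOf θ Pr) a V ∂(fieldMeasure (Par θ Pr) (lev θ Pr) (SU N)))
    (hsupp : ∀ θ, Adm θ → ∀ Pr : B12.RunParams, (repDataOfSel (rOf θ Pr) (selOf θ Pr) (fibOf θ Pr)).ProvisosSupp)
    (hP1 : ∀ θ, Adm θ → ∀ Pr : B12.RunParams, Prop1Printed (LF θ Pr))
    (h180 : ∀ θ, Adm θ → ∀ (Pr : B12.RunParams) U, new189 (D189 θ Pr) U → ∀ i, (D189 θ Pr).h ≤ i → i ≤ (D189 θ Pr).k →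
      ∀ p ∈ plaqsOf (dom (D189 θ Pr) i),
      Ineq180 ((D189 θ Pr).dev0 U p) ((D189 θ Pr).ε (D189 θ Pr).k) (D189 θ Pr).η (D189 θ Pr).B₃ (D189 θ Pr).B₅ (D189 θ Pr).M
        (D189 θ Pr).δ ((D189 θ Pr).dist p) (D189 θ Pr).O1)
    (h189 : ∀ θ, Adm θ → ∀ Pr : B12.RunParams, Claim189 (new189 (D189 θ Pr)) (chiPP (D189 θ Pr)))
    (hw : ∃ θ, Adm θ ∧ ∀ Pr, w.up Pr = upOfRecord₅C F N (toS5 θ) Pr) (Pr : B12.RunParams) : Dag.B15_main (leavesP w Pr) := by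
  refine b15_main_of_refines₅C_of_leaf toS5 Adm (fun θ hθ Pr => ?_) hw Pr
  rw [hpin θ hθ Pr]
  obtain ⟨Cρ, hCρ⟩ := hC θ hθ Pr
  exact b15Leaf_WOfRepr_rPrimeDataOfSel_of_mass _ _ _ _ _ (hm θ hθ Pr) (h0 θ hθ Pr) hCρ (hmass θ hθ Pr) (hsupp θ hθ Pr) (hP1 θ hθ Pr)
    (h180 θ hθ Pr) (h189 θ hθ Pr)

end Hook

/-! ## §4. At the represented tower of record (def-T's `RepTowerOfRecord`): the tower W pin WITH the (1.100) data pinned -/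

section Tower

variable {F : T4Family} {N : ℕ} [NeZero N]
variable (ν : Stage7Numerics) (τ : TowerNumerics) (E : B12.RunParams → ℝ) (sw : StepWeightsOfRecord F N ν τ.M)
  (ppSel : PpSelOfRecord F ν τ.M) (p : B12.RunParams) (g : ℕ → ℝ) (k : ℕ) [DecidableEq (PBond (F.P p.K) (k + 1))]
  {P₀ : Params} {C ι : Type} (LF : B15.LFVar) (D189 : Setting189 P₀ (SU N) C ι)

/-- **THE [IV] LEAF AT THE TOWER PIN WITH `D1100 := rPrimeDataOfSel (Tstep rep_k) (ppSel p g (k+1)) (fibOfSeq … (k+1))`**: from the pre-𝐑 terms of the tower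
of record measurable ∕ ≥ 0 ∕ bounded ∕ of positive mass, def-R's support-form provisos of those terms, and EXACTLY Proposition 1 (1.78), (1.80), (1.89) —
(0.4), (0.6), (1.102) are theorems ((1.102) at `𝐓ρ_k` of record, `sum_rterm_repTOfRecord9`). [cite: Balaban1989LargeFieldI, (0.2)–(0.6) p.176, Prop. 1 (1.78) p.194, (1.80) p.195, (1.89) p.198, (1.99)–(1.102) pp.200–201; Balaban1988Convergent, (3.25) p.270] -/
theorem b15Leaf_WOfTower9_rPrimeDataOfSel_of_mass (hm : ∀ s, Measurable (rterm (repTOfRecord9 F N ν τ E sw ppSel p g k) s))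
    (h0 : ∀ s V, 0 ≤ rterm (repTOfRecord9 F N ν τ E sw ppSel p g k) s V) {Cρ : ℝ}
    (hC : ∀ s V, rterm (repTOfRecord9 F N ν τ E sw ppSel p g k) s V ≤ Cρ)
    (hmass : ∀ s, 0 < ∫ V, rterm (repTOfRecord9 F N ν τ E sw ppSel p g k) s V ∂(fieldMeasure (F.P p.K) (k + 1) (SU N)))
    (hsupp : (repDataOfSel (repTOfRecord9 F N ν τ E sw ppSel p g k) (ppSel p g (k + 1)) (fibOfSeq F ν τ p g (k + 1))).ProvisosSupp)
    (hP1 : Prop1Printed LF)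
    (h180 : ∀ U, new189 D189 U → ∀ i, D189.h ≤ i → i ≤ D189.k → ∀ q ∈ plaqsOf (dom D189 i),
      Ineq180 (D189.dev0 U q) (D189.ε D189.k) D189.η D189.B₃ D189.B₅ D189.M D189.δ (D189.dist q) D189.O1)
    (h189 : Claim189 (new189 D189) (chiPP D189)) :
    B15Leaf (WOfRepr (repTOfRecord9 F N ν τ E sw ppSel p g k) (ppSel p g (k + 1)) (fibOfSeq F ν τ p g (k + 1)) LF D189
      (rPrimeDataOfSel (repTOfRecord9 F N ν τ E sw ppSel p g k) (ppSel p g (k + 1)) (fibOfSeq F ν τ p g (k + 1)))) :=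
  b15Leaf_WOfRepr_rPrimeDataOfSel_of_mass _ _ _ LF D189 hm h0 hC hmass hsupp hP1 h180 h189

/-- **(1.102) FOR `𝐓ρ_k` OF RECORD at the pinned (1.100) data, from def-R's support-form provisos ALONE** (no display): `Normalization1102 (rPrimeDataOfSel
(Tstep rep_k) …) (trhoOfRecord9 … k)`. [cite: Balaban1989LargeFieldI, (1.102) p.201; Balaban1988Convergent, (3.25) p.270] -/
theorem normalization1102_trhoOfRecord9_rPrimeDataOfSel
    (hsupp : (repDataOfSel (repTOfRecord9 F N ν τ E sw ppSel p g k) (ppSel p g (k + 1)) (fibOfSeq F ν τ p g (k + 1))).ProvisosSupp) :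
    Normalization1102 (rPrimeDataOfSel (repTOfRecord9 F N ν τ E sw ppSel p g k) (ppSel p g (k + 1)) (fibOfSeq F ν τ p g (k + 1)))
      (trhoOfRecord9 F N ν τ E sw ppSel p g k) := by
  rw [← sum_rterm_repTOfRecord9]
  exact normalization1102_rPrimeDataOfSel_supp _ _ _ hsupp

end Tower

section TowerHook

variable {F : T4Family} {N : ℕ} [NeZero N] {w : WorldP}

/-- **N12 OF RECORD AT THE REPRESENTED TOWER WITH THE (1.100) DATA PINNED** — n12-a's `b15_main_of_refines₅C_WOfTower9` with `D1100 θ P := rPrimeDataOfSel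
(Tstep rep_k) (sel θ P _ (k θ P + 1)) (fibOfSeq … (k θ P + 1))` and its `h1102` REPLACED by def-R's support-form provisos of the pre-𝐑 terms (a field of the
Stage-10 record's `Provisos₁₀.rstep`): N12 = `Dag.B15_main (leavesP w P)` at every run of every record world from the pre-𝐑 terms measurable ∕ ≥ 0 ∕ bounded
∕ of positive mass, their support-form provisos, and EXACTLY Proposition 1 (1.78), (1.80) on the ℍ-domains, (1.89).  THE discharge shape of N12 at the tower
modulo THREE of [IV]'s printed statements. [cite: Balaban1989LargeFieldI, Prop. 1 (1.78) p.194, (0.2)–(0.6) p.176, (1.80) p.195, (1.89) p.198, (1.99)–(1.102) pp.200–201; Balaban1988Convergent, (2.18) p.257, (3.25) p.270] -/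
theorem b15_main_of_refines₅C_WOfTower9_rPrimeDataOfSel {Θ : Type*} (toS5 : Θ → Stage5Params F N) (Adm : Θ → Prop)
    (ν : Θ → Stage7Numerics) (τ : Θ → TowerNumerics) (E : Θ → B12.RunParams → ℝ) (sw : ∀ θ, StepWeightsOfRecord F N (ν θ) (τ θ).M)
    (sel : ∀ θ, PpSelOfRecord F (ν θ) (τ θ).M) (g : Θ → B12.RunParams → ℕ → ℝ) (k : Θ → B12.RunParams → ℕ)
    [∀ θ (Pr : B12.RunParams), DecidableEq (PBond (F.P Pr.K) (k θ Pr + 1))]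
    {P₀ : Θ → B12.RunParams → Params} {Cfg ι : Θ → B12.RunParams → Type}
    (LF : Θ → B12.RunParams → B15.LFVar) (D189 : ∀ θ Pr, Setting189 (P₀ θ Pr) (SU N) (Cfg θ Pr) (ι θ Pr))
    (hpin : ∀ θ, Adm θ → ∀ Pr : B12.RunParams,
      (toS5 θ).res.W Pr = WOfRepr (repTOfRecord9 F N (ν θ) (τ θ) (E θ) (sw θ) (sel θ) Pr (g θ Pr) (k θ Pr))
        (sel θ Pr (g θ Pr) (k θ Pr + 1)) (fibOfSeq F (ν θ) (τ θ) Pr (g θ Pr) (k θ Pr + 1)) (LF θ Pr) (D189 θ Pr)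
        (rPrimeDataOfSel (repTOfRecord9 F N (ν θ) (τ θ) (E θ) (sw θ) (sel θ) Pr (g θ Pr) (k θ Pr)) (sel θ Pr (g θ Pr) (k θ Pr + 1))
          (fibOfSeq F (ν θ) (τ θ) Pr (g θ Pr) (k θ Pr + 1))))
    (hm : ∀ θ, Adm θ → ∀ (Pr : B12.RunParams) s, Measurable (rterm (repTOfRecord9 F N (ν θ) (τ θ) (E θ) (sw θ) (sel θ) Pr (g θ Pr) (k θ Pr)) s))
    (h0 : ∀ θ, Adm θ → ∀ (Pr : B12.RunParams) s V, 0 ≤ rterm (repTOfRecord9 F N (ν θ) (τ θ) (E θ) (sw θ) (sel θ) Pr (g θ Pr) (k θ Pr)) s V)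
    (hC : ∀ θ, Adm θ → ∀ Pr : B12.RunParams, ∃ Cρ : ℝ, ∀ s V,
      rterm (repTOfRecord9 F N (ν θ) (τ θ) (E θ) (sw θ) (sel θ) Pr (g θ Pr) (k θ Pr)) s V ≤ Cρ)
    (hmass : ∀ θ, Adm θ → ∀ (Pr : B12.RunParams) s,
      0 < ∫ V, rterm (repTOfRecord9 F N (ν θ) (τ θ) (E θ) (sw θ) (sel θ) Pr (g θ Pr) (k θ Pr)) s V ∂(fieldMeasure (F.P Pr.K) (k θ Pr + 1) (SU N)))
    (hsupp : ∀ θ, Adm θ → ∀ Pr : B12.RunParams,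
      (repDataOfSel (repTOfRecord9 F N (ν θ) (τ θ) (E θ) (sw θ) (sel θ) Pr (g θ Pr) (k θ Pr)) (sel θ Pr (g θ Pr) (k θ Pr + 1))
        (fibOfSeq F (ν θ) (τ θ) Pr (g θ Pr) (k θ Pr + 1))).ProvisosSupp)
    (hP1 : ∀ θ, Adm θ → ∀ Pr : B12.RunParams, Prop1Printed (LF θ Pr))
    (h180 : ∀ θ, Adm θ → ∀ (Pr : B12.RunParams) U, new189 (D189 θ Pr) U → ∀ i, (D189 θ Pr).h ≤ i → i ≤ (D189 θ Pr).k →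
      ∀ q ∈ plaqsOf (dom (D189 θ Pr) i),
      Ineq180 ((D189 θ Pr).dev0 U q) ((D189 θ Pr).ε (D189 θ Pr).k) (D189 θ Pr).η (D189 θ Pr).B₃ (D189 θ Pr).B₅ (D189 θ Pr).M
        (D189 θ Pr).δ ((D189 θ Pr).dist q) (D189 θ Pr).O1)
    (h189 : ∀ θ, Adm θ → ∀ Pr : B12.RunParams, Claim189 (new189 (D189 θ Pr)) (chiPP (D189 θ Pr)))
    (hw : ∃ θ, Adm θ ∧ ∀ Pr, w.up Pr = upOfRecord₅C F N (toS5 θ) Pr) (Pr : B12.RunParams) : Dag.B15_main (leavesP w Pr) := by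
  refine b15_main_of_refines₅C_of_leaf toS5 Adm (fun θ hθ Pr => ?_) hw Pr
  rw [hpin θ hθ Pr]
  obtain ⟨Cρ, hCρ⟩ := hC θ hθ Pr
  exact b15Leaf_WOfTower9_rPrimeDataOfSel_of_mass (ν θ) (τ θ) (E θ) (sw θ) (sel θ) Pr (g θ Pr) (k θ Pr) (LF θ Pr) (D189 θ Pr)
    (hm θ hθ Pr) (h0 θ hθ Pr) hCρ (hmass θ hθ Pr) (hsupp θ hθ Pr) (hP1 θ hθ Pr) (h180 θ hθ Pr) (h189 θ hθ Pr)

end TowerHook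

end Literature.MathematicalPhysics.QuantumFieldTheory.Balaban1983to89.B15RPrime1100OfRep

end
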